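import Literature.InformationTheory.QuantumCodes.RotatedSurfaceCodeLift
import HarnessLib

/-!
# The `Z`-check graph of the rotated surface code drawn on the diagonal square lattice: `Z`-faces as sites of `ℤ²`,
# qubits as bonds, incidence = geometry, and the hand-shaking lemma for an odd ROW-`0` crossing (every `L ≥ 2`)

Topic `Literature/InformationTheory/QuantumCodes` (venture QEC, rung Q5, row 09; qec-type-09 gen 6, item «09.RSCSAWZ»
successor: the second lift, needed for EVEN `L` where no isometry of the grid exchanges the two colours). All PROVED, kernel
axioms, no named fact. `RotatedSurfaceCodeLift.lean` draws the `X`-check graph of type-08's `RSC(L)`; this file is its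
twin for the `Z`-checks: the `Z`-face `(a, b') ∈ Fin (L-1) × Fin (L+1)` (valid when `a + b'` is even, meeting rows
`{a, a+1}` and columns `{b'-1, b'}`) goes to the site `((a+b')/2, (b'-a)/2) ∈ ℤ²` (`zsite`; `u - v = a`, `u + v = b'`);
the qubit `(i, j)` becomes the vertical unit bond `{((i+j)/2, (j-i)/2), ((i+j)/2, (j-i)/2 + 1)}` if `i + j` is even and the
horizontal one `{((i+j-1)/2, (j-i+1)/2), ((i+j+1)/2, (j-i+1)/2)}` if odd (`zbond`); the rough edges of this sector are the
qubit ROWS `i = 0` (virtual faces `a = -1`, the diagonal `u - v = -1`) and `i = L-1` (`u - v = L-1`).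

* `HZ_apply_eq_ite_of_valid` — **incidence is geometry**: for a valid `Z`-face `z`, `H_Z[z, q] = [zsite z ∈ zbond q]`;
  `zsite` is injective on valid faces; `zbond` is injective; the two ends of a bond are adjacent in `ℤ²`;
* `rscLiftZ Er` — the bond configuration opened by a set of qubits; `vbotZ j` / `vtopZ j` — the virtual ends of the dangling
  bonds of the qubits `(0, j)` / `(L-1, j)`;
* ★ `rsc_existsZ_reachable_top_of_odd` — **hand-shaking**: for `L ≥ 2`, a cycle `c` of the sector (`H_Z c = 0`) supported in
  `Er` with an ODD number of qubits in row `0` joins some `vbotZ j₀` to some `vtopZ j₁` through bonds of `Er`.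

## References

* [DennisEtAl2002] E. Dennis, A. Kitaev, A. Landahl, J. Preskill, *Topological quantum memory*, J. Math. Phys. 43 (2002)
  4452–4505, arXiv:quant-ph/0110143, §3.2 (planar codes: rough edges, relative cycles), §5.3 ("To bound the failure
  probability for a planar code rather than the toric code, we should count the 'relative polygons' that stretch from one
  edge of the lattice to the opposite edge. This change has no effect on the estimate of the threshold.").
* [TomitaSvore2014] PRA 90 (2014) 062320, §2.2 (rotated layout); [BombinMartinDelgado2007Optimal] PRA 76 (2007) 012305, §IV.
-/

namespace Literature.InformationTheory.QuantumCodes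

namespace RotatedSurface

open Finset Matrix
open Literature.Probability.LatticeModels (Site zdGraph zdGraph_adj_iff)
open Literature.Probability.Percolation (BondConfig openGraph openGraph_adj)
open Literature.Probability.RandomPlanarGeometry.SAW.Zd (zdGraph_adj_iff_sub)

variable {L : ℕ}

/-! ### Sites and bonds -/

/-- Sites are determined by their coordinates. [folklore] -/
private theorem spt_eq_spt_iff' {u v u' v' : ℤ} : spt u v = spt u' v' ↔ u = u' ∧ v = v' := by
  refine ⟨fun h => ?_, by rintro ⟨rfl, rfl⟩; rfl⟩
  exact ⟨by simpa [spt] using congrFun h 0, by simpa [spt] using congrFun h 1⟩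

/-- **The site of a `Z`-face** `(a, b')`: `((a+b')/2, (b'-a)/2)` (exact for the valid faces, `a + b'` even).
[cite: TomitaSvore2014, §2.2 (the Z stabilizers of the rotated layout)] -/
def zsite (z : Fin (L - 1) × Fin (L + 1)) : Site 2 :=
  spt (((z.1.val : ℤ) + z.2.val) / 2) (((z.2.val : ℤ) - z.1.val) / 2)

/-- **The `Z`-bond of a qubit** `(i, j)`: vertical `{((i+j)/2, (j-i)/2), ((i+j)/2, (j-i)/2 + 1)}` if `i + j` is even,
horizontal `{((i+j-1)/2, (j-i+1)/2), ((i+j-1)/2 + 1, (j-i+1)/2)}` if `i + j` is odd — the sites of the two `Z`-faces of the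
right colour among `{i-1, i} × {j, j+1}` (possibly virtual, `a = -1` or `a = L-1`).
[cite: TomitaSvore2014, §2.2 (each data qubit of the rotated layout meets at most two Z stabilizers)] -/
def zbond (q : Fin L × Fin L) : Sym2 (Site 2) :=
  if (q.1.val + q.2.val) % 2 = 0 then
    s(spt (((q.1.val : ℤ) + q.2.val) / 2) (((q.2.val : ℤ) - q.1.val) / 2),
      spt (((q.1.val : ℤ) + q.2.val) / 2) (((q.2.val : ℤ) - q.1.val) / 2 + 1))
  else
    s(spt (((q.1.val : ℤ) + q.2.val - 1) / 2) (((q.2.val : ℤ) - q.1.val + 1) / 2),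
      spt (((q.1.val : ℤ) + q.2.val - 1) / 2 + 1) (((q.2.val : ℤ) - q.1.val + 1) / 2))

/-- Advancing a site by a unit vector. [folklore] -/
private theorem spt_add_single' (u v : ℤ) :
    spt u v + Pi.single 0 1 = spt (u + 1) v ∧ spt u v + Pi.single 1 1 = spt u (v + 1) := by
  refine ⟨?_, ?_⟩ <;> funext j <;> fin_cases j <;> simp [spt]

/-- **The two ends of the `Z`-bond of a qubit are adjacent sites of `ℤ²`.** [cite: TomitaSvore2014, §2.2] -/
theorem zdGraph_adj_of_zbond_eq (q : Fin L × Fin L) {P P' : Site 2} (h : zbond q = s(P, P')) :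
    (zdGraph 2).Adj P P' := by
  have key : ∀ (u v : ℤ) (i : Fin 2), (zdGraph 2).Adj (spt u v) (spt u v + Pi.single i 1) := fun u v i => by
    rw [zdGraph_adj_iff_sub]; exact ⟨i, Or.inl (by simp)⟩
  have fin : ∀ {A B : Site 2}, (zdGraph 2).Adj A B → s(A, B) = s(P, P') → (zdGraph 2).Adj P P' := by
    intro A B hAB hs
    rcases Sym2.eq_iff.1 hs with ⟨rfl, rfl⟩ | ⟨rfl, rfl⟩; exacts [hAB, hAB.symm]
  unfold zbond at h
  split_ifs at h with hq
  · have hA := key (((q.1.val : ℤ) + q.2.val) / 2) (((q.2.val : ℤ) - q.1.val) / 2) 1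
    rw [(spt_add_single' _ _).2] at hA
    exact fin hA h
  · have hA := key (((q.1.val : ℤ) + q.2.val - 1) / 2) (((q.2.val : ℤ) - q.1.val + 1) / 2) 0
    rw [(spt_add_single' _ _).1] at hA
    exact fin hA h

/-- **The `Z`-bond map is injective.** [cite: TomitaSvore2014, §2.2 (distinct data qubits)] -/
theorem zbond_injective : Function.Injective (zbond (L := L)) := by
  rintro ⟨i, j⟩ ⟨i', j'⟩ h
  simp only [zbond] at h
  split_ifs at h with h1 h2 h2 <;>
    simp only [Sym2.eq_iff, spt_eq_spt_iff', Prod.mk.injEq, Fin.ext_iff] at h h1 h2 ⊢ <;> omega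

/-- **`zsite` is injective on the valid `Z`-faces.** [cite: TomitaSvore2014, §2.2] -/
theorem zsite_injOn {z z' : Fin (L - 1) × Fin (L + 1)} (hz : (z.1.val + z.2.val) % 2 = 0)
    (hz' : (z'.1.val + z'.2.val) % 2 = 0) (h : zsite z = zsite z') : z = z' := by
  obtain ⟨a, b⟩ := z
  obtain ⟨a', b'⟩ := z'
  simp only [zsite, spt_eq_spt_iff', Prod.mk.injEq, Fin.ext_iff] at h hz hz' ⊢
  omega

/-- For a valid `Z`-face, `u - v = a ≥ 0` and `≤ L - 2`: face sites lie strictly between the two virtual diagonals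
`u - v = -1` (row `0` side) and `u - v = L - 1` (row `L-1` side). [cite: DennisEtAl2002, §3.2 (the checks between the two rough edges)] -/
theorem zsite_sub_eq {z : Fin (L - 1) × Fin (L + 1)} (hz : (z.1.val + z.2.val) % 2 = 0) :
    zsite z 0 - zsite z 1 = z.1.val := by
  simp only [zsite, spt, Matrix.cons_val_zero, Matrix.cons_val_one]
  omega

/-! ### Incidence is geometry -/

/-- **`H_Z[z, q] = [zsite z ∈ zbond q]` for every VALID `Z`-face `z`**: the face `(a, b')` meets the qubit `(i, j)` iff
`a ∈ {i-1, i}` and `b' ∈ {j, j+1}`, i.e. iff its site is an end of the `Z`-bond of `(i, j)`.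
[cite: TomitaSvore2014, §2.2 (Z stabilizers of the rotated layout)] -/
theorem HZ_apply_eq_ite_of_valid {z : Fin (L - 1) × Fin (L + 1)} (hz : (z.1.val + z.2.val) % 2 = 0) (q : Fin L × Fin L) :
    HZ L z q = if zsite z ∈ zbond q then 1 else 0 := by
  classical
  obtain ⟨a, b⟩ := z
  obtain ⟨i, j⟩ := q
  have key : zsite (a, b) ∈ zbond (i, j) ↔ (i.val = a.val ∨ i.val = a.val + 1) ∧ (j.val + 1 = b.val ∨ j.val = b.val) := by
    unfold zbond
    simp only at hz ⊢
    split_ifs with hq <;> simp only [zsite, Sym2.mem_iff, spt_eq_spt_iff'] <;> omega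
  simp only [HZ, vz, rz, cz, key]
  simp only at hz
  rw [if_pos hz, one_mul]
  by_cases h1 : (i.val = a.val ∨ i.val = a.val + 1) <;> by_cases h2 : (j.val + 1 = b.val ∨ j.val = b.val) <;> simp [h1, h2]

/-- **The `Z`-syndrome at a valid face is the parity of the chain on the bonds at its site.**
[cite: DennisEtAl2002, §3.2 (defects at the ends of error chains)] -/
theorem HZ_mulVec_apply_eq_sum_of_valid {z : Fin (L - 1) × Fin (L + 1)} (hz : (z.1.val + z.2.val) % 2 = 0)
    (c : Fin L × Fin L → ZMod 2) : (HZ L *ᵥ c) z = ∑ q, if zsite z ∈ zbond q then c q else 0 := by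
  classical
  simp only [mulVec, dotProduct, HZ_apply_eq_ite_of_valid hz]
  exact Finset.sum_congr rfl fun q _ => by split_ifs <;> simp

/-! ### The lift, the virtual ends, and the hand-shaking lemma -/

/-- **The `Z`-lift** of a set of qubits: the bond configuration of `ℤ²` whose open bonds are their `Z`-bonds.
[cite: DennisEtAl2002, §3.2 (error chains as links)] -/
def rscLiftZ (Er : Finset (Fin L × Fin L)) : BondConfig (Site 2) := {e | ∃ q ∈ Er, zbond q = e}

/-- A qubit of `Er` opens its `Z`-bond. [cite: DennisEtAl2002, §3.2] -/
theorem rscLiftZ_adj_of_mem {Er : Finset (Fin L × Fin L)} {q : Fin L × Fin L} (hq : q ∈ Er) {P P' : Site 2}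
    (h : zbond q = s(P, P')) : (openGraph (rscLiftZ Er)).Adj P P' := by
  rw [openGraph_adj]
  exact ⟨⟨q, hq, h⟩, (zdGraph_adj_of_zbond_eq q h).ne⟩

/-- **The virtual (bottom) end of the dangling `Z`-bond of the qubit `(0, j)`**, on the diagonal `u - v = -1`.
[cite: DennisEtAl2002, §3.2 (rough edge: links with one end off the lattice)] -/
def vbotZ (j : Fin L) : Site 2 :=
  if j.val % 2 = 0 then spt ((j.val : ℤ) / 2) ((j.val : ℤ) / 2 + 1) else spt (((j.val : ℤ) - 1) / 2) (((j.val : ℤ) + 1) / 2)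

/-- **The virtual (top) end of the dangling `Z`-bond of the qubit `(L-1, j)`**, on the diagonal `u - v = L-1`.
[cite: DennisEtAl2002, §3.2 (the opposite rough edge)] -/
def vtopZ (j : Fin L) : Site 2 :=
  if (j.val + (L - 1)) % 2 = 0 then spt (((j.val : ℤ) + (L - 1 : ℕ)) / 2) (((j.val : ℤ) - (L - 1 : ℕ)) / 2)
  else spt (((j.val : ℤ) + (L - 1 : ℕ) + 1) / 2) (((j.val : ℤ) - (L - 1 : ℕ) + 1) / 2)

/-- In `ℤ₂`, the indicator of membership in a genuine pair is the sum of the two point indicators. [folklore] -/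
private theorem ite_mem_sym2_eq_add' {P A B : Site 2} (hAB : A ≠ B) :
    (if P ∈ s(A, B) then (1 : ZMod 2) else 0) = (if P = A then 1 else 0) + (if P = B then 1 else 0) := by
  classical
  simp only [Sym2.mem_iff]
  by_cases hA : P = A
  · rw [if_pos (Or.inl hA), if_pos hA, if_neg (fun h => hAB (hA.symm.trans h)), add_zero]
  · by_cases hB : P = B
    · rw [if_pos (Or.inr hB), if_neg hA, if_pos hB, zero_add]
    · rw [if_neg (not_or.2 ⟨hA, hB⟩), if_neg hA, if_neg hB, add_zero]

/-- ★ **Hand-shaking: an odd row-`0` crossing reaches the opposite rough edge.** For `L ≥ 2`, let `c` be a cycle of the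
`H_Z` sector of `RSC(L)` (`H_Z c = 0`) supported in `Er` with an odd number of qubits in row `0`. Then some bottom virtual site
`vbotZ j₀` is joined, through `Z`-bonds of `Er`, to some top virtual site `vtopZ j₁`. (Sum the vanishing syndrome over the valid
`Z`-faces reachable from the bottom edge: a bond between two faces contributes `0` or `2`, a row-`0` bond `1`, a row-`L-1` bond
`0` unless the top edge is reachable.) [cite: DennisEtAl2002, §3.2 and §5.3 (relative polygons stretching from one edge to the opposite edge)] -/
theorem rsc_existsZ_reachable_top_of_odd (hL : 2 ≤ L) {Er : Finset (Fin L × Fin L)} {c : Fin L × Fin L → ZMod 2}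
    (hc : HZ L *ᵥ c = 0) (hcE : ∀ q, c q ≠ 0 → q ∈ Er)
    (hodd : ∑ j : Fin L, c (⟨0, by omega⟩, j) = 1) :
    ∃ j₀ j₁ : Fin L, (openGraph (rscLiftZ Er)).Reachable (vbotZ j₀) (vtopZ j₁) := by
  classical
  by_contra hno
  push Not at hno
  set G := openGraph (rscLiftZ Er) with hG
  set R : Site 2 → Prop := fun P => ∃ j₀ : Fin L, G.Reachable (vbotZ j₀) P with hR
  have hRadj : ∀ {P P' : Site 2}, G.Adj P P' → (R P ↔ R P') := fun h =>
    ⟨fun ⟨j₀, hr⟩ => ⟨j₀, hr.trans h.reachable⟩, fun ⟨j₀, hr⟩ => ⟨j₀, hr.trans h.symm.reachable⟩⟩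
  set V : Fin (L - 1) × Fin (L + 1) → Prop := fun z => (z.1.val + z.2.val) % 2 = 0 with hV
  set χ : Fin (L - 1) × Fin (L + 1) → ZMod 2 := fun z => if V z ∧ R (zsite z) then 1 else 0 with hχ
  set f : Site 2 → ZMod 2 := fun P => ∑ z, if V z ∧ zsite z = P then χ z else 0 with hf
  have hf_site : ∀ z₀, V z₀ → f (zsite z₀) = χ z₀ := fun z₀ hz₀ => by
    simp only [hf]
    rw [Finset.sum_eq_single z₀, if_pos ⟨hz₀, rfl⟩]
    · exact fun z _ hz => if_neg fun h => hz (zsite_injOn h.1 hz₀ h.2)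
    · intro h; exact absurd (Finset.mem_univ _) h
  have hf_virtual : ∀ P : Site 2, (∀ z : Fin (L - 1) × Fin (L + 1), V z → zsite z ≠ P) → f P = 0 := fun P hP => by
    simp only [hf]
    exact Finset.sum_eq_zero fun z _ => if_neg fun h => hP z h.1 h.2
  -- `g q = Σ_z χ(z) H_Z(z, q) = f(P₁) + f(P₂)` for the `Z`-bond `{P₁, P₂}` of `q`
  have hg : ∀ (q : Fin L × Fin L) {P₁ P₂ : Site 2}, zbond q = s(P₁, P₂) →
      ∑ z, χ z * HZ L z q = f P₁ + f P₂ := by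
    intro q P₁ P₂ hq
    have hne : P₁ ≠ P₂ := (zdGraph_adj_of_zbond_eq q hq).ne
    simp only [hf, ← Finset.sum_add_distrib]
    refine Finset.sum_congr rfl fun z _ => ?_
    by_cases hz : V z
    · rw [HZ_apply_eq_ite_of_valid hz, hq, ite_mem_sym2_eq_add' hne]
      by_cases h1 : zsite z = P₁
      · have h2 : zsite z ≠ P₂ := fun h => hne (h1.symm.trans h)
        rw [if_pos h1, if_neg h2, if_pos ⟨hz, h1⟩, if_neg (fun h => h2 h.2)]; ring
      · by_cases h2 : zsite z = P₂
        · rw [if_neg h1, if_pos h2, if_neg (fun h => h1 h.2), if_pos ⟨hz, h2⟩]; ring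
        · rw [if_neg h1, if_neg h2, if_neg (fun h => h1 h.2), if_neg (fun h => h2 h.2)]; ring
    · have h0 : HZ L z q = 0 := by rw [HZ_eq_zero_of_invalid z hz]; rfl
      rw [h0, mul_zero, if_neg (fun h => hz h.1), if_neg (fun h => hz h.1), add_zero]
  -- the row-`0` indicator
  set bot : Fin L × Fin L → ZMod 2 := fun q => if q.1.val = 0 then 1 else 0 with hbot
  -- evaluation of `g` on the open bonds
  have hval : ∀ q ∈ Er, ∑ z, χ z * HZ L z q = bot q := by
    rintro ⟨i, j⟩ hq
    simp only [hbot]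
    by_cases hpar : (i.val + j.val) % 2 = 0
    · -- vertical bond between the faces `(i, j)` (lower end) and `(i-1, j+1)` (upper end)
      have hB : zbond (i, j) = s(spt (((i.val : ℤ) + j.val) / 2) (((j.val : ℤ) - i.val) / 2),
          spt (((i.val : ℤ) + j.val) / 2) (((j.val : ℤ) - i.val) / 2 + 1)) := by
        unfold zbond; rw [if_pos hpar]
      rw [hg _ hB]
      have hadj := rscLiftZ_adj_of_mem hq hB
      by_cases hi0 : i.val = 0
      · -- row `0`: the lower end is the valid face `(0, j)`, the upper end is `vbotZ j` (virtual)
        rw [if_pos hi0]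
        have hj : j.val % 2 = 0 := by omega
        have h2 : f (spt (((i.val : ℤ) + j.val) / 2) (((j.val : ℤ) - i.val) / 2 + 1)) = 0 := by
          refine hf_virtual _ fun z hz hze => ?_
          obtain ⟨a, b⟩ := z
          simp only [zsite, spt_eq_spt_iff', hV] at hze hz
          omega
        have hzv : V (⟨0, by omega⟩, ⟨j.val, by omega⟩) := by simp only [hV]; omega
        have hz1 : zsite ((⟨0, by omega⟩, ⟨j.val, by omega⟩) : Fin (L - 1) × Fin (L + 1)) =
            spt (((i.val : ℤ) + j.val) / 2) (((j.val : ℤ) - i.val) / 2) := by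
          unfold zsite; rw [spt_eq_spt_iff']; dsimp only; omega
        have h1 : f (spt (((i.val : ℤ) + j.val) / 2) (((j.val : ℤ) - i.val) / 2)) = 1 := by
          rw [← hz1, hf_site _ hzv, hχ]
          simp only
          rw [if_pos]
          refine ⟨hzv, (hRadj (hz1 ▸ hadj)).2 ⟨j, ?_⟩⟩
          have hvb : vbotZ j = spt (((i.val : ℤ) + j.val) / 2) (((j.val : ℤ) - i.val) / 2 + 1) := by
            unfold vbotZ; rw [if_pos hj, spt_eq_spt_iff']; omega
          rw [hvb]
        rw [h1, h2, add_zero]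
      · rw [if_neg hi0]
        by_cases hiL : i.val = L - 1
        · -- row `L-1`: the lower end is `vtopZ j` (virtual), the upper end is the valid face `(L-2, j+1)`
          have h1 : f (spt (((i.val : ℤ) + j.val) / 2) (((j.val : ℤ) - i.val) / 2)) = 0 := by
            refine hf_virtual _ fun z hz hze => ?_
            obtain ⟨a, b⟩ := z
            have ha := a.2
            simp only [zsite, spt_eq_spt_iff', hV] at hze hz
            omega
          have hzv : V (⟨i.val - 1, by omega⟩, ⟨j.val + 1, by omega⟩) := by simp only [hV]; omega
          have hz2 : zsite ((⟨i.val - 1, by omega⟩, ⟨j.val + 1, by omega⟩) : Fin (L - 1) × Fin (L + 1)) =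
              spt (((i.val : ℤ) + j.val) / 2) (((j.val : ℤ) - i.val) / 2 + 1) := by
            unfold zsite; rw [spt_eq_spt_iff']; dsimp only; push_cast [Nat.cast_sub (show 1 ≤ i.val by omega)]; omega
          have h2 : f (spt (((i.val : ℤ) + j.val) / 2) (((j.val : ℤ) - i.val) / 2 + 1)) = 0 := by
            rw [← hz2, hf_site _ hzv, hχ]
            simp only
            rw [if_neg]
            rintro ⟨-, j₀, hr⟩
            refine hno j₀ j ?_
            have hvt : vtopZ j = spt (((i.val : ℤ) + j.val) / 2) (((j.val : ℤ) - i.val) / 2) := by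
              unfold vtopZ
              rw [if_pos (by omega), spt_eq_spt_iff']
              push_cast [Nat.cast_sub (show 1 ≤ L by omega)]
              omega
            rw [hvt]
            exact (hz2 ▸ hr).trans hadj.symm.reachable
          rw [h1, h2, add_zero]
        · -- interior: both ends are valid faces `(i, j)` and `(i-1, j+1)`
          have hzv1 : V (⟨i.val, by omega⟩, ⟨j.val, by omega⟩) := by simp only [hV]; omega
          have hzv2 : V (⟨i.val - 1, by omega⟩, ⟨j.val + 1, by omega⟩) := by simp only [hV]; omega
          have hz1 : zsite ((⟨i.val, by omega⟩, ⟨j.val, by omega⟩) : Fin (L - 1) × Fin (L + 1)) =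
              spt (((i.val : ℤ) + j.val) / 2) (((j.val : ℤ) - i.val) / 2) := by
            unfold zsite; rw [spt_eq_spt_iff']; dsimp only; omega
          have hz2 : zsite ((⟨i.val - 1, by omega⟩, ⟨j.val + 1, by omega⟩) : Fin (L - 1) × Fin (L + 1)) =
              spt (((i.val : ℤ) + j.val) / 2) (((j.val : ℤ) - i.val) / 2 + 1) := by
            unfold zsite; rw [spt_eq_spt_iff']; dsimp only; push_cast [Nat.cast_sub (show 1 ≤ i.val by omega)]; omega
          rw [← hz1, ← hz2, hf_site _ hzv1, hf_site _ hzv2, hχ]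
          simp only
          have hiff := hRadj (hz1 ▸ hz2 ▸ hadj)
          by_cases hr : R (zsite ((⟨i.val, by omega⟩, ⟨j.val, by omega⟩) : Fin (L - 1) × Fin (L + 1)))
          · rw [if_pos ⟨hzv1, hr⟩, if_pos ⟨hzv2, hiff.1 hr⟩]; decide
          · rw [if_neg (fun h => hr h.2), if_neg (fun h => hr (hiff.2 h.2)), add_zero]
    · -- horizontal bond between the faces `(i-1, j)` (left end) and `(i, j+1)` (right end)
      have hB : zbond (i, j) = s(spt (((i.val : ℤ) + j.val - 1) / 2) (((j.val : ℤ) - i.val + 1) / 2),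
          spt (((i.val : ℤ) + j.val - 1) / 2 + 1) (((j.val : ℤ) - i.val + 1) / 2)) := by
        unfold zbond; rw [if_neg hpar]
      rw [hg _ hB]
      have hadj := rscLiftZ_adj_of_mem hq hB
      by_cases hi0 : i.val = 0
      · -- row `0`: the left end `vbotZ j` is virtual, the right end is the valid face `(0, j+1)`
        rw [if_pos hi0]
        have hj : j.val % 2 = 1 := by omega
        have h1 : f (spt (((i.val : ℤ) + j.val - 1) / 2) (((j.val : ℤ) - i.val + 1) / 2)) = 0 := by
          refine hf_virtual _ fun z hz hze => ?_
          obtain ⟨a, b⟩ := z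
          simp only [zsite, spt_eq_spt_iff', hV] at hze hz
          omega
        have hzv : V (⟨0, by omega⟩, ⟨j.val + 1, by omega⟩) := by simp only [hV]; omega
        have hz2 : zsite ((⟨0, by omega⟩, ⟨j.val + 1, by omega⟩) : Fin (L - 1) × Fin (L + 1)) =
            spt (((i.val : ℤ) + j.val - 1) / 2 + 1) (((j.val : ℤ) - i.val + 1) / 2) := by
          unfold zsite; rw [spt_eq_spt_iff']; dsimp only; push_cast; omega
        have h2 : f (spt (((i.val : ℤ) + j.val - 1) / 2 + 1) (((j.val : ℤ) - i.val + 1) / 2)) = 1 := by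
          rw [← hz2, hf_site _ hzv, hχ]
          simp only
          rw [if_pos]
          refine ⟨hzv, (hRadj (hz2 ▸ hadj)).1 ⟨j, ?_⟩⟩
          have hvb : vbotZ j = spt (((i.val : ℤ) + j.val - 1) / 2) (((j.val : ℤ) - i.val + 1) / 2) := by
            unfold vbotZ; rw [if_neg (by omega), spt_eq_spt_iff']; omega
          rw [hvb]
        rw [h1, h2, zero_add]
      · rw [if_neg hi0]
        by_cases hiL : i.val = L - 1
        · -- row `L-1`: the left end is the valid face `(L-2, j)`, the right end `vtopZ j` is virtual
          have hzv : V (⟨i.val - 1, by omega⟩, ⟨j.val, by omega⟩) := by simp only [hV]; omega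
          have hz1 : zsite ((⟨i.val - 1, by omega⟩, ⟨j.val, by omega⟩) : Fin (L - 1) × Fin (L + 1)) =
              spt (((i.val : ℤ) + j.val - 1) / 2) (((j.val : ℤ) - i.val + 1) / 2) := by
            unfold zsite; rw [spt_eq_spt_iff']; dsimp only; push_cast [Nat.cast_sub (show 1 ≤ i.val by omega)]; omega
          have h1 : f (spt (((i.val : ℤ) + j.val - 1) / 2) (((j.val : ℤ) - i.val + 1) / 2)) = 0 := by
            rw [← hz1, hf_site _ hzv, hχ]
            simp only
            rw [if_neg]
            rintro ⟨-, j₀, hr⟩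
            refine hno j₀ j ?_
            have hvt : vtopZ j = spt (((i.val : ℤ) + j.val - 1) / 2 + 1) (((j.val : ℤ) - i.val + 1) / 2) := by
              unfold vtopZ
              rw [if_neg (by omega), spt_eq_spt_iff']
              push_cast [Nat.cast_sub (show 1 ≤ L by omega)]
              omega
            rw [hvt]
            exact (hz1 ▸ hr).trans hadj.reachable
          have h2 : f (spt (((i.val : ℤ) + j.val - 1) / 2 + 1) (((j.val : ℤ) - i.val + 1) / 2)) = 0 := by
            refine hf_virtual _ fun z hz hze => ?_
            obtain ⟨a, b⟩ := z
            have ha := a.2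
            simp only [zsite, spt_eq_spt_iff', hV] at hze hz
            omega
          rw [h1, h2, add_zero]
        · -- interior: both ends are valid faces `(i-1, j)` and `(i, j+1)`
          have hzv1 : V (⟨i.val - 1, by omega⟩, ⟨j.val, by omega⟩) := by simp only [hV]; omega
          have hzv2 : V (⟨i.val, by omega⟩, ⟨j.val + 1, by omega⟩) := by simp only [hV]; omega
          have hz1 : zsite ((⟨i.val - 1, by omega⟩, ⟨j.val, by omega⟩) : Fin (L - 1) × Fin (L + 1)) =
              spt (((i.val : ℤ) + j.val - 1) / 2) (((j.val : ℤ) - i.val + 1) / 2) := by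
            unfold zsite; rw [spt_eq_spt_iff']; dsimp only; push_cast [Nat.cast_sub (show 1 ≤ i.val by omega)]; omega
          have hz2 : zsite ((⟨i.val, by omega⟩, ⟨j.val + 1, by omega⟩) : Fin (L - 1) × Fin (L + 1)) =
              spt (((i.val : ℤ) + j.val - 1) / 2 + 1) (((j.val : ℤ) - i.val + 1) / 2) := by
            unfold zsite; rw [spt_eq_spt_iff']; dsimp only; push_cast; omega
          rw [← hz1, ← hz2, hf_site _ hzv1, hf_site _ hzv2, hχ]
          simp only
          have hiff := hRadj (hz1 ▸ hz2 ▸ hadj)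
          by_cases hr : R (zsite ((⟨i.val - 1, by omega⟩, ⟨j.val, by omega⟩) : Fin (L - 1) × Fin (L + 1)))
          · rw [if_pos ⟨hzv1, hr⟩, if_pos ⟨hzv2, hiff.1 hr⟩]; decide
          · rw [if_neg (fun h => hr h.2), if_neg (fun h => hr (hiff.2 h.2)), add_zero]
  -- (1) the total syndrome over the reachable valid faces vanishes; (2) swap the sums
  have h1 : ∑ z, χ z * (HZ L *ᵥ c) z = 0 := Finset.sum_eq_zero fun z _ => by rw [hc, Pi.zero_apply, mul_zero]
  have h2 : ∑ z, χ z * (HZ L *ᵥ c) z = ∑ q, c q * ∑ z, χ z * HZ L z q := by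
    simp only [mulVec, dotProduct, Finset.mul_sum]
    exact Finset.sum_comm.trans (Finset.sum_congr rfl fun q _ => Finset.sum_congr rfl fun z _ => by ring)
  -- (3) only the row-`0` bonds survive
  have h3 : ∑ q, c q * ∑ z, χ z * HZ L z q = ∑ q, c q * bot q := by
    refine Finset.sum_congr rfl fun q _ => ?_
    by_cases hc0 : c q = 0
    · rw [hc0, zero_mul, zero_mul]
    · rw [hval q (hcE q hc0)]
  -- (4) and they add up to the row-`0` crossing number
  have h4 : ∑ q, c q * bot q = ∑ j : Fin L, c (⟨0, by omega⟩, j) := by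
    simp only [hbot, Fintype.sum_prod_type, mul_ite, mul_one, mul_zero]
    rw [Finset.sum_eq_single (⟨0, by omega⟩ : Fin L)]
    · simp
    · intro i _ hi
      refine Finset.sum_eq_zero fun j _ => ?_
      rw [if_neg]
      exact fun h => hi (Fin.ext h)
    · intro h; exact absurd (Finset.mem_univ _) h
  rw [h2, h3, h4, hodd] at h1
  exact one_ne_zero h1

end RotatedSurface

end Literature.InformationTheory.QuantumCodes
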